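import Mathlib
import HarnessLib.Audit
import Summits.PneNP.PneNP.Theorems.PstarCrossCornerReads
import Summits.PneNP.PneNP.Theorems.PstarCrossCaseP

/-!
# The blind free CROSS gate, node N1 (`CrossCasePEmpty`), step 1: regime P is automatic, the corner is a level set of `q_{(1,0)}`, and the SECOND constraint touches no GOOD private tree edge (O2 / E1; prover-1 g22)

FRONTIER range-avoidance ladder, rung F-N3 (`stmt-PneNP-19007`), cell `pnp-ideate`; restricted-model proof complexity — nothing here bears on `P` versus `NP`.

Node N1 of `PstarCrossNodes`: cross data `B` with NO real chord besides the two gate chords (`(N.erase e_q).erase e_p = ∅`).  Then: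

* `singleRead_of_empty` — the virtual system is single-read (regime P holds automatically);
* `corner_const` — `q_{(1,0)} ≡ 1` on the corner `{u_p = u_q = 0}` (`PstarCrossCaseP.orU_of_q`), so the corner-square machinery
  (`PstarCrossCorner`, `PstarCrossCornerReads`) applies to `q_{(1,0)} = F₂ + t₂`;
* `Avail` — a switching set (private tree edges switched on inside the corner) avoiding a given set of edges exists; a private tree edge `π` is GOOD when
  for every private tree edge `k` a switching set avoids both `π` and `k`;
* **`w₂_untouched`** — the second constraint reads NEITHER AND variable of a good private tree edge, neither linearly nor through a monomial.
Which private edges are good is decided by the sizes of the Venn classes of `(D_p, D_q)` among the private edges and the levels `γ_p, γ_q`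
(`avail_of_*`): e.g. at levels `(0,0)` every private edge is good (the empty switching set), and at level `γ_p = 1` two private edges of `D_p ∖ D_q`
other than `π, k` — or one of `D_p ∩ D_q` — suffice.  The bad edges are the planner's pinned classes (memo §14.42); with `PstarCrossBudget` (every
private edge is touched, `#(J₀∖N) + 3 ≤ 2 + 2·#Pv`) the node reduces to the first constraint's reads and the pinned configurations.
-/

set_option linter.dupNamespace false -- `Summit.PneNP.PneNP.…`: summit = sub-problem name (D-0017 single-conjunct layout)

open Finset Literature.Computability.Complexity
open Summit.PneNP.PneNP.Theorems.PstarFibrePolys (bit)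
open Summit.PneNP.PneNP.Theorems.PstarTyped (Typed)
open Summit.PneNP.PneNP.Theorems.PstarSALevel (varSet BoundaryExpanding SimpleOverlap)
open Summit.PneNP.PneNP.Theorems.PstarCentreFree (vars_mem_varSet)
open Summit.PneNP.PneNP.Theorems.PstarReadSumset (V2)
open Summit.PneNP.PneNP.Theorems.PstarChordSystem (ChordSystem)
open Summit.PneNP.PneNP.Theorems.PstarChordBridgeTools
open Summit.PneNP.PneNP.Theorems.PstarChordBridge
open Summit.PneNP.PneNP.Theorems.PstarChordBridgeForcing (gam)
open Summit.PneNP.PneNP.Theorems.PstarChordBridgeBasis (qDir polarDir)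
open Summit.PneNP.PneNP.Theorems.PstarCrossData (CrossData)
open Summit.PneNP.PneNP.Theorems.PstarCrossSystem
open Summit.PneNP.PneNP.Theorems.PstarCrossCorner (PrivEdge)
open Summit.PneNP.PneNP.Theorems.PstarCrossCornerReads (Switch not_mem_C₂ G₂_avoid)
open Summit.PneNP.PneNP.Theorems.PstarCrossCaseP (orU_of_q)

namespace Summit.PneNP.PneNP.Theorems.PstarCrossCasePEmptyW2

variable {n m : ℕ}

section

variable (I : LocalMap 4 n m) {r : ℕ} {B : BridgeData n m} {e_p e_q g₀ : Fin m}

/-- **With no real chord besides the gate chords the virtual system is single-read** (regime P is automatic in node N1). -/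
theorem singleRead_of_empty (hD : CrossData I r B e_p e_q g₀) (hE : (B.N.erase e_q).erase e_p = ∅) : ((sys I B).vsys e_p e_q).SingleRead := by
  intro e a
  rw [ChordSystem.vsys_ρ, ChordSystem.vsys_ρ']
  by_cases heN : e ∈ B.N
  · obtain ⟨hp, hp', hq, hq'⟩ := reads_pq I hD a
    by_cases hep : e = e_p
    · subst hep; rw [hp, hp']; exact ⟨rfl, rfl⟩
    by_cases heq : e = e_q
    · subst heq; rw [hq, hq']; exact ⟨rfl, rfl⟩
    · have : e ∈ (B.N.erase e_q).erase e_p := mem_erase.2 ⟨hep, mem_erase.2 ⟨heq, heN⟩⟩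
      rw [hE] at this
      exact absurd this (notMem_empty e)
  · obtain ⟨h1, h2⟩ := sys_ρ_of_not_mem I B heN a
    rw [h1, h2]; exact ⟨rfl, rfl⟩

/-- **The corner is inside the level set `{q_{(1,0)} = 1}`** (regime P). -/
theorem corner_const (hI : I.IsPure xorAndPred) (hT : Typed I) (hD : CrossData I r B e_p e_q g₀) (hSR : ((sys I B).vsys e_p e_q).SingleRead) :
    ∀ a, (sys I B).u e_p a = 0 → (sys I B).u e_q a = 0 → qDir I B (1, 0) a = 1 := by
  intro a hp hq
  rcases (by decide : ∀ t : ZMod 2, t = 0 ∨ t = 1) (qDir I B (1, 0) a) with h0 | h1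
  · have h := orU_of_q I hI hT hD hSR h0
    rw [(sys I B).orU_eq_one_iff, hp, hq] at h
    rcases h with h | h <;> exact absurd h (by decide)
  · exact h1

/-! ## Availability of switching sets and good edges -/

/-- A switching set avoiding the edges of `X` exists. -/
def Avail (I : LocalMap 4 n m) (B : BridgeData n m) (e_p e_q : Fin m) (X : Finset (Fin m)) : Prop :=
  ∃ S : Finset (Fin m), Switch I B e_p e_q S ∧ Disjoint S X

/-- An AND variable of a private tree edge lies in no other private tree edge. -/
theorem privEdge_unique {j k : Fin m} (hj : PrivEdge I B j) (hk : PrivEdge I B k) {s : Fin 4} (hs : s = 2 ∨ s = 3)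
    (hu : I.vars j s ∈ varSet I k) : j = k := by
  by_contra hne
  have h2 := hj.2 k (mem_sdiff.1 hk.1).1 (Ne.symm hne)
  rcases hs with rfl | rfl
  · exact h2.1 hu
  · exact h2.2 hu

/-- An AND variable of an edge of a set `S` of private edges that avoids the private edge `j` is not an AND variable of `j`. -/
theorem not_mem_privs_of_disjoint {S : Finset (Fin m)} (hS : ∀ j ∈ S, PrivEdge I B j) {j : Fin m} (hj : PrivEdge I B j) (hjS : j ∉ S)
    {u : Fin n} {s : Fin 4} (hs : s = 2 ∨ s = 3) (hu : I.vars j s = u) : u ∉ privs I S := by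
  intro huS
  obtain ⟨j', hj', hj'u⟩ := (mem_privs I).1 huS
  have hmem : I.vars j s ∈ varSet I j' := by
    rcases hj'u with h | h
    · rw [hu, ← h]; exact vars_mem_varSet I j' 2
    · rw [hu, ← h]; exact vars_mem_varSet I j' 3
  exact hjS ((privEdge_unique I hj (hS j' hj') hs hmem) ▸ hj')

/-- **The second constraint touches no GOOD private tree edge** (node N1, regime P): if for every private tree edge `k` some switching set avoids `π`
and `k`, then `w₂` reads neither AND variable of `π`, neither linearly nor through a monomial. -/
theorem w₂_untouched (hI : I.IsPure xorAndPred) (hT : Typed I) (hS : SimpleOverlap I) (hD : CrossData I r B e_p e_q g₀)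
    (hSR : ((sys I B).vsys e_p e_q).SingleRead) {π : Fin m} (hπ : PrivEdge I B π)
    (havail : ∀ k, PrivEdge I B k → Avail I B e_p e_q {π, k}) :
    (I.vars π 2 ∉ B.C₂ ∧ I.vars π 3 ∉ B.C₂) ∧
      ∀ g ∈ B.G₂, I.vars g 2 ≠ I.vars π 2 ∧ I.vars g 3 ≠ I.vars π 2 ∧ I.vars g 2 ≠ I.vars π 3 ∧ I.vars g 3 ≠ I.vars π 3 := by
  classical
  have hK := corner_const I hI hT hD hSR
  -- a switching set avoiding `π`
  obtain ⟨S₀, hS₀, hd₀⟩ := havail π hπ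
  have hπS₀ : π ∉ S₀ := fun h => disjoint_left.1 hd₀ h (mem_insert_self π _)
  -- switching sets avoiding `π` and the edge of a given AND variable
  have hlin : ∀ u ∈ privs I S₀, ∃ S, Switch I B e_p e_q S ∧ π ∉ S ∧ u ∉ privs I S := by
    intro u hu
    obtain ⟨j, hj, hju⟩ := (mem_privs I).1 hu
    obtain ⟨S, hSw, hd⟩ := havail j (hS₀.1 j hj)
    refine ⟨S, hSw, fun h => disjoint_left.1 hd h (mem_insert_self π _), ?_⟩
    have hjS : j ∉ S := fun h => disjoint_left.1 hd h (mem_insert_of_mem (mem_singleton_self j))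
    rcases hju with h | h
    · exact not_mem_privs_of_disjoint I hSw.1 (hS₀.1 j hj) hjS (Or.inl rfl) h
    · exact not_mem_privs_of_disjoint I hSw.1 (hS₀.1 j hj) hjS (Or.inr rfl) h
  have hmon : ∀ w, w ≠ I.vars π 2 → w ≠ I.vars π 3 → ∃ S, Switch I B e_p e_q S ∧ π ∉ S ∧ w ∉ privs I S := by
    intro w _ _
    by_cases hw : ∃ k, PrivEdge I B k ∧ (I.vars k 2 = w ∨ I.vars k 3 = w)
    · obtain ⟨k, hk, hkw⟩ := hw
      obtain ⟨S, hSw, hd⟩ := havail k hk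
      refine ⟨S, hSw, fun h => disjoint_left.1 hd h (mem_insert_self π _), ?_⟩
      have hkS : k ∉ S := fun h => disjoint_left.1 hd h (mem_insert_of_mem (mem_singleton_self k))
      rcases hkw with h | h
      · exact not_mem_privs_of_disjoint I hSw.1 hk hkS (Or.inl rfl) h
      · exact not_mem_privs_of_disjoint I hSw.1 hk hkS (Or.inr rfl) h
    · refine ⟨S₀, hS₀, hπS₀, fun hwS => hw ?_⟩
      obtain ⟨j, hj, hjw⟩ := (mem_privs I).1 hwS
      exact ⟨j, hS₀.1 j hj, hjw⟩
  refine ⟨⟨not_mem_C₂ I hI hT hD hK hπ (Or.inl rfl) hS₀ hπS₀ hlin, not_mem_C₂ I hI hT hD hK hπ (Or.inr rfl) hS₀ hπS₀ hlin⟩, fun g hg => ?_⟩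
  have h2 := G₂_avoid I hI hS hD hK hπ (Or.inl rfl) hmon g hg
  have h3 := G₂_avoid I hI hS hD hK hπ (Or.inr rfl) hmon g hg
  exact ⟨h2.1, h2.2, h3.1, h3.2⟩

/-! ## Availability from class counts -/

/-- Levels `(γ_p, γ_q) = (0, 0)`: the empty switching set avoids everything. -/
theorem avail_of_levels_zero (hp : gam B e_p = 0) (hq : gam B e_q = 0) (X : Finset (Fin m)) : Avail I B e_p e_q X :=
  ⟨∅, ⟨fun _ h => absurd h (notMem_empty _), by simp [hp], by simp [hq]⟩, disjoint_empty_left X⟩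

/-- A single private edge `j` of `D_p ∖ D_q` switched on realises the levels `(1, 0)`. -/
theorem switch_single_A {j : Fin m} (hj : PrivEdge I B j) (hjp : j ∈ B.D e_p) (hjq : j ∉ B.D e_q) (hp : gam B e_p = 1) (hq : gam B e_q = 0) :
    Switch I B e_p e_q {j} := by
  refine ⟨fun k hk => by rw [mem_singleton.1 hk]; exact hj, ?_, ?_⟩
  · rw [filter_mem_eq_inter, inter_singleton_of_mem hjp, card_singleton, hp]; decide
  · rw [filter_mem_eq_inter, inter_singleton_of_notMem hjq, card_empty, hq]; simp

/-- A single private edge `j` of `D_q ∖ D_p` switched on realises the levels `(0, 1)`. -/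
theorem switch_single_B {j : Fin m} (hj : PrivEdge I B j) (hjp : j ∉ B.D e_p) (hjq : j ∈ B.D e_q) (hp : gam B e_p = 0) (hq : gam B e_q = 1) :
    Switch I B e_p e_q {j} := by
  refine ⟨fun k hk => by rw [mem_singleton.1 hk]; exact hj, ?_, ?_⟩
  · rw [filter_mem_eq_inter, inter_singleton_of_notMem hjp, card_empty, hp]; simp
  · rw [filter_mem_eq_inter, inter_singleton_of_mem hjq, card_singleton, hq]; decide

/-- A single private edge `j` of `D_p ∩ D_q` switched on realises the levels `(1, 1)`. -/
theorem switch_single_C {j : Fin m} (hj : PrivEdge I B j) (hjp : j ∈ B.D e_p) (hjq : j ∈ B.D e_q) (hp : gam B e_p = 1) (hq : gam B e_q = 1) :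
    Switch I B e_p e_q {j} := by
  refine ⟨fun k hk => by rw [mem_singleton.1 hk]; exact hj, ?_, ?_⟩
  · rw [filter_mem_eq_inter, inter_singleton_of_mem hjp, card_singleton, hp]; decide
  · rw [filter_mem_eq_inter, inter_singleton_of_mem hjq, card_singleton, hq]; decide

/-- A private edge of `D_p ∖ D_q` and one of `D_q ∖ D_p` switched on realise the levels `(1, 1)`. -/
theorem switch_pair_AB {j k : Fin m} (hj : PrivEdge I B j) (hk : PrivEdge I B k) (hjp : j ∈ B.D e_p) (hjq : j ∉ B.D e_q)
    (hkp : k ∉ B.D e_p) (hkq : k ∈ B.D e_q) (hp : gam B e_p = 1) (hq : gam B e_q = 1) : Switch I B e_p e_q {j, k} := by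
  classical
  have hjk : j ≠ k := fun h => hkp (h ▸ hjp)
  refine ⟨fun l hl => by rcases mem_insert.1 hl with rfl | hl; exacts [hj, (mem_singleton.1 hl) ▸ hk], ?_, ?_⟩
  · have : (B.D e_p).filter (fun l => l ∈ ({j, k} : Finset (Fin m))) = {j} := by
      ext l; simp only [mem_filter, mem_insert, mem_singleton]
      constructor
      · rintro ⟨hl, rfl | rfl⟩
        · rfl
        · exact absurd hl hkp
      · rintro rfl; exact ⟨hjp, Or.inl rfl⟩
    rw [this, card_singleton, hp]; decide
  · have : (B.D e_q).filter (fun l => l ∈ ({j, k} : Finset (Fin m))) = {k} := by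
      ext l; simp only [mem_filter, mem_insert, mem_singleton]
      constructor
      · rintro ⟨hl, rfl | rfl⟩
        · exact absurd hl hjq
        · rfl
      · rintro rfl; exact ⟨hkq, Or.inr rfl⟩
    rw [this, card_singleton, hq]; decide

end

end Summit.PneNP.PneNP.Theorems.PstarCrossCasePEmptyW2
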